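import Summits.ValiantsHypothesis.ValiantsHypothesis.Theorems.KPlusLogSqLawTridiagonalRealStaticPotentialSteps

/-!
# Route «KPlusLogSqLaw», crux `WeakLifting` (stmt-ValiantsHypothesis-19561) — REAL side of the tridiagonal sector:
# double zeros of the `4 × 4` continuant are NONDEGENERATE MAXIMA (no zero of multiplicity `≥ 3`)

HONEST FRAMING.  Helper (`--supports stmt-ValiantsHypothesis-19561 --as helper`), seat val-sym-lift-p3 (g10), cell `pub-symmetroid`,
2026-08-27; first half of «`B 4 ≤ 3` WITH MULTIPLICITY» (the hypothesis of `potentialStep_two_of_fourMult`).  For a static definite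
symmetric tridiagonal `4 × 4` monomial design with nonzero links, `D₄ = T₀ − T₁ − T₂ − T₃ + T₄` with the five positive monomials
`T₀ = a₃a₂a₁a₀X^{Σd}`, `T₁ = a₃a₂b₀²X^{d₃+d₂+2f₀}`, `T₂ = a₃a₀b₁²X^{d₃+d₀+2f₁}`, `T₃ = a₁a₀b₂²X^{d₁+d₀+2f₂}`, `T₄ = b₀²b₂²X^{2f₀+2f₂}` and
`T₀T₄ = T₁T₃`.  THE SECOND-ORDER IDENTITY (`euler_two_neg`): at a point `x > 0` where `Σ sₖtₖ = 0` and `Σ sₖnₖtₖ = 0` (the values and Euler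
weights of the five terms), `Σ sₖnₖ²tₖ = −(p²t₁(t₀−t₃)² + r²t₃(t₀−t₁)²)/((t₀−t₁)(t₀−t₃)) < 0` (`p = n₁−n₀`, `r = n₃−n₀`; `(t₀−t₁)(t₀−t₃) = t₀t₂ > 0`)
unless all five exponents coincide.  Consequences (`x·D₄′ = Σ sₖnₖtₖ`, `x²D₄″ + xD₄′ = Σ sₖnₖ²tₖ`): **`derivative_two_neg_of_double_root`** — at a
positive zero of `D₄` where `D₄′` vanishes, `D₄″ < 0`; **`rootMultiplicity_pathDet_four_le_two`** — no positive zero of `D₄ ≠ 0` has multiplicity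
`≥ 3`.  (The companion file turns this + the cell's `B 4 ≤ 3` into `Σ mult ≤ 3` by perturbing `b₁`.)  Nothing here bears on `WeakLifting` /
`TropicalB` (stmt-19771) in their windows, on Conjecture B, on the Door-A registers, on `MatrixDescartes` (stmt-ValiantsHypothesis-18050) or on
VP ≠ VNP.
[folklore: Euler operator on fewnomials; this cell's memo CONDITIONAL-UPPER-ROW-liftp3g10.md §5]
-/

-- `Summit.ValiantsHypothesis.ValiantsHypothesis.…` repeats a component by the D-0017 layout (single-conjunct summit); the name is mandated.
set_option linter.dupNamespace false
set_option autoImplicit false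

namespace Summit.ValiantsHypothesis.ValiantsHypothesis.Theorems.KPlusLogSqLaw

namespace StaticTridiagonalRealPotential

open Polynomial

/-! ### The key real inequality -/

/-- **The second-order identity/inequality.**  Positive reals `t₀ … t₄` with `t₀t₄ = t₁t₃`, real weights `n₀ … n₄` with `n₄ = n₁ + n₃ − n₀`:
if `t₀ − t₁ − t₂ − t₃ + t₄ = 0` and `n₀t₀ − n₁t₁ − n₂t₂ − n₃t₃ + n₄t₄ = 0` and not `n₁ = n₀ = n₃`, then
`n₀²t₀ − n₁²t₁ − n₂²t₂ − n₃²t₃ + n₄²t₄ < 0`. [folklore; this file] -/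
theorem euler_two_neg (t₀ t₁ t₂ t₃ t₄ n₀ n₁ n₂ n₃ n₄ : ℝ) (h0 : 0 < t₀) (h1 : 0 < t₁) (h2 : 0 < t₂) (h3 : 0 < t₃)
    (H : t₀ * t₄ = t₁ * t₃) (hn : n₄ = n₁ + n₃ - n₀) (E0 : t₀ - t₁ - t₂ - t₃ + t₄ = 0)
    (E1 : n₀ * t₀ - n₁ * t₁ - n₂ * t₂ - n₃ * t₃ + n₄ * t₄ = 0) (hnd : n₁ ≠ n₀ ∨ n₃ ≠ n₀) :
    n₀ ^ 2 * t₀ - n₁ ^ 2 * t₁ - n₂ ^ 2 * t₂ - n₃ ^ 2 * t₃ + n₄ ^ 2 * t₄ < 0 := by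
  -- reduced weights and the two differences
  set p := n₁ - n₀ with hp
  set r := n₃ - n₀ with hr
  set q := n₂ - n₀ with hq
  set A := t₀ - t₁ with hA
  set B := t₀ - t₃ with hB
  have ht4 : t₄ = t₁ * t₃ / t₀ := by field_simp; linarith [H]
  have hAB : t₂ * t₀ = A * B := by rw [hA, hB]; linear_combination (-t₀) * E0 + H
  have hABpos : 0 < A * B := by rw [← hAB]; positivity
  -- `q · (A·B) = −(p t₁ B + r t₃ A)`
  have E1' : -p * t₁ - q * t₂ - r * t₃ + (p + r) * t₄ = 0 := by
    rw [hp, hq, hr]; rw [hn] at E1; linear_combination E1 - n₀ * E0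
  have hM : q * (A * B) = -(p * t₁ * B + r * t₃ * A) := by
    rw [← hAB, hA, hB]; linear_combination (-t₀) * E1' + (p + r) * H
  have hA0 : A ≠ 0 := fun h => by rw [h, zero_mul] at hABpos; exact lt_irrefl _ hABpos
  have hB0 : B ≠ 0 := fun h => by rw [h, mul_zero] at hABpos; exact lt_irrefl _ hABpos
  have ht2 : t₂ = A * B / t₀ := by rw [eq_div_iff h0.ne']; linarith [hAB]
  have hqq : q = -(p * t₁ * B + r * t₃ * A) / (A * B) := by rw [eq_div_iff (mul_ne_zero hA0 hB0)]; linarith [hM]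
  -- the value in reduced weights
  have hshift : n₀ ^ 2 * t₀ - n₁ ^ 2 * t₁ - n₂ ^ 2 * t₂ - n₃ ^ 2 * t₃ + n₄ ^ 2 * t₄ =
      -p ^ 2 * t₁ - q ^ 2 * t₂ - r ^ 2 * t₃ + (p + r) ^ 2 * t₄ := by
    rw [hp, hq, hr]; rw [hn] at E1 ⊢; linear_combination (2 * n₀) * E1 - n₀ ^ 2 * E0
  rw [hshift]
  have hclosed : -p ^ 2 * t₁ - q ^ 2 * t₂ - r ^ 2 * t₃ + (p + r) ^ 2 * t₄ =
      -(p ^ 2 * t₁ * B ^ 2 + r ^ 2 * t₃ * A ^ 2) / (A * B) := by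
    rw [hqq, ht2, ht4]
    field_simp
    ring
  rw [hclosed, div_neg_iff]
  refine Or.inr ⟨?_, hABpos⟩
  rw [neg_lt_zero]
  -- `p ≠ 0 ∨ r ≠ 0`
  rcases hnd with h | h
  · have hp0 : p ≠ 0 := by rw [hp]; exact sub_ne_zero.2 h
    have : 0 < p ^ 2 * t₁ * B ^ 2 := by positivity
    have : 0 ≤ r ^ 2 * t₃ * A ^ 2 := by positivity
    linarith
  · have hr0 : r ≠ 0 := by rw [hr]; exact sub_ne_zero.2 h
    have : 0 < r ^ 2 * t₃ * A ^ 2 := by positivity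
    have : 0 ≤ p ^ 2 * t₁ * B ^ 2 := by positivity
    linarith

/-! ### Euler weights of a monomial -/

/-- `x · (c X^n)′(x) = n · c x^n`. [folklore] -/
theorem mul_eval_derivative_C_mul_X_pow (c x : ℝ) (n : ℕ) :
    x * (derivative (C c * X ^ n)).eval x = (n : ℝ) * (c * x ^ n) := by
  rw [derivative_C_mul_X_pow, eval_mul, eval_C, eval_pow, eval_X]
  rcases n with _ | m
  · simp
  · rw [Nat.add_sub_cancel, pow_succ]; push_cast; ring

/-- `x² · (c X^n)″(x) + x · (c X^n)′(x) = n² · c x^n`. [folklore] -/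
theorem sq_mul_eval_derivative_two_C_mul_X_pow (c x : ℝ) (n : ℕ) :
    x ^ 2 * (derivative (derivative (C c * X ^ n))).eval x + x * (derivative (C c * X ^ n)).eval x = (n : ℝ) ^ 2 * (c * x ^ n) := by
  rw [mul_eval_derivative_C_mul_X_pow, derivative_C_mul_X_pow, derivative_C_mul_X_pow, eval_mul, eval_C, eval_pow, eval_X]
  rcases n with _ | _ | m
  · simp
  · simp
  · rw [show m + 1 + 1 - 1 = m + 1 from rfl, show m + 1 - 1 = m from rfl, pow_succ, pow_succ]
    push_cast
    ring

/-! ### The explicit five-term form of `D₄` and its Euler sums -/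

variable (a : ℕ → ℝ) (d : ℕ → ℕ) (b : ℕ → ℝ) (f : ℕ → ℕ)

/-- `D₄ = T₀ − T₁ − T₂ − T₃ + T₄` (the five matchings of the path on four vertices). [folklore: continuants] -/
theorem pathDet_four : pathDet a d b f 4 =
    C (a 3 * a 2 * a 1 * a 0) * X ^ (d 3 + d 2 + d 1 + d 0) - C (a 3 * a 2 * b 0 ^ 2) * X ^ (d 3 + d 2 + 2 * f 0) -
      C (a 3 * a 0 * b 1 ^ 2) * X ^ (d 3 + d 0 + 2 * f 1) - C (a 1 * a 0 * b 2 ^ 2) * X ^ (d 1 + d 0 + 2 * f 2) +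
      C (b 0 ^ 2 * b 2 ^ 2) * X ^ (2 * f 0 + 2 * f 2) := by
  rw [show (4 : ℕ) = 2 + 2 from rfl, pathDet_add_two, show (2 + 1 : ℕ) = 1 + 2 from rfl, pathDet_add_two, pathDet_two, pathDet_one]
  simp only [map_mul, map_pow, map_neg]
  ring

/-- Value of `D₄`. [this file] -/
theorem eval_pathDet_four (x : ℝ) : (pathDet a d b f 4).eval x =
    a 3 * a 2 * a 1 * a 0 * x ^ (d 3 + d 2 + d 1 + d 0) - a 3 * a 2 * b 0 ^ 2 * x ^ (d 3 + d 2 + 2 * f 0) -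
      a 3 * a 0 * b 1 ^ 2 * x ^ (d 3 + d 0 + 2 * f 1) - a 1 * a 0 * b 2 ^ 2 * x ^ (d 1 + d 0 + 2 * f 2) +
      b 0 ^ 2 * b 2 ^ 2 * x ^ (2 * f 0 + 2 * f 2) := by
  rw [pathDet_four]; simp only [eval_add, eval_sub, eval_mul, eval_C, eval_pow, eval_X]

/-- First Euler sum `x · D₄′(x)`. [this file] -/
theorem mul_eval_derivative_pathDet_four (x : ℝ) : x * (derivative (pathDet a d b f 4)).eval x =
    ((d 3 + d 2 + d 1 + d 0 : ℕ) : ℝ) * (a 3 * a 2 * a 1 * a 0 * x ^ (d 3 + d 2 + d 1 + d 0)) -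
      ((d 3 + d 2 + 2 * f 0 : ℕ) : ℝ) * (a 3 * a 2 * b 0 ^ 2 * x ^ (d 3 + d 2 + 2 * f 0)) -
      ((d 3 + d 0 + 2 * f 1 : ℕ) : ℝ) * (a 3 * a 0 * b 1 ^ 2 * x ^ (d 3 + d 0 + 2 * f 1)) -
      ((d 1 + d 0 + 2 * f 2 : ℕ) : ℝ) * (a 1 * a 0 * b 2 ^ 2 * x ^ (d 1 + d 0 + 2 * f 2)) +
      ((2 * f 0 + 2 * f 2 : ℕ) : ℝ) * (b 0 ^ 2 * b 2 ^ 2 * x ^ (2 * f 0 + 2 * f 2)) := by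
  rw [pathDet_four]
  simp only [derivative_add, derivative_sub, eval_add, eval_sub, mul_add, mul_sub, mul_eval_derivative_C_mul_X_pow]

/-- Second Euler sum `x² · D₄″(x) + x · D₄′(x)`. [this file] -/
theorem sq_mul_eval_derivative_two_pathDet_four (x : ℝ) :
    x ^ 2 * (derivative (derivative (pathDet a d b f 4))).eval x + x * (derivative (pathDet a d b f 4)).eval x =
    ((d 3 + d 2 + d 1 + d 0 : ℕ) : ℝ) ^ 2 * (a 3 * a 2 * a 1 * a 0 * x ^ (d 3 + d 2 + d 1 + d 0)) -
      ((d 3 + d 2 + 2 * f 0 : ℕ) : ℝ) ^ 2 * (a 3 * a 2 * b 0 ^ 2 * x ^ (d 3 + d 2 + 2 * f 0)) -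
      ((d 3 + d 0 + 2 * f 1 : ℕ) : ℝ) ^ 2 * (a 3 * a 0 * b 1 ^ 2 * x ^ (d 3 + d 0 + 2 * f 1)) -
      ((d 1 + d 0 + 2 * f 2 : ℕ) : ℝ) ^ 2 * (a 1 * a 0 * b 2 ^ 2 * x ^ (d 1 + d 0 + 2 * f 2)) +
      ((2 * f 0 + 2 * f 2 : ℕ) : ℝ) ^ 2 * (b 0 ^ 2 * b 2 ^ 2 * x ^ (2 * f 0 + 2 * f 2)) := by
  have h := fun c n => sq_mul_eval_derivative_two_C_mul_X_pow c x n
  rw [pathDet_four]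
  simp only [derivative_add, derivative_sub, eval_add, eval_sub]
  have e0 := h (a 3 * a 2 * a 1 * a 0) (d 3 + d 2 + d 1 + d 0)
  have e1 := h (a 3 * a 2 * b 0 ^ 2) (d 3 + d 2 + 2 * f 0)
  have e2 := h (a 3 * a 0 * b 1 ^ 2) (d 3 + d 0 + 2 * f 1)
  have e3 := h (a 1 * a 0 * b 2 ^ 2) (d 1 + d 0 + 2 * f 2)
  have e4 := h (b 0 ^ 2 * b 2 ^ 2) (2 * f 0 + 2 * f 2)
  linear_combination e0 - e1 - e2 - e3 + e4

/-! ### Double zeros are nondegenerate maxima; no zero of multiplicity three -/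

/-- **(M) At a positive double zero of `D₄ ≠ 0`, `D₄″ < 0`** (links nonzero, diagonal positive). [this file] -/
theorem derivative_two_neg_of_double_root (ha : ∀ t, 0 < a t) (hb : ∀ t, b t ≠ 0) (hP : pathDet a d b f 4 ≠ 0) {x : ℝ} (hx : 0 < x)
    (h0 : (pathDet a d b f 4).eval x = 0) (h1 : (derivative (pathDet a d b f 4)).eval x = 0) :
    (derivative (derivative (pathDet a d b f 4))).eval x < 0 := by
  -- the five terms and weights
  set t₀ := a 3 * a 2 * a 1 * a 0 * x ^ (d 3 + d 2 + d 1 + d 0) with ht₀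
  set t₁ := a 3 * a 2 * b 0 ^ 2 * x ^ (d 3 + d 2 + 2 * f 0) with ht₁
  set t₂ := a 3 * a 0 * b 1 ^ 2 * x ^ (d 3 + d 0 + 2 * f 1) with ht₂
  set t₃ := a 1 * a 0 * b 2 ^ 2 * x ^ (d 1 + d 0 + 2 * f 2) with ht₃
  set t₄ := b 0 ^ 2 * b 2 ^ 2 * x ^ (2 * f 0 + 2 * f 2) with ht₄
  have hb0 : 0 < b 0 ^ 2 := lt_of_le_of_ne (sq_nonneg _) (Ne.symm (pow_ne_zero 2 (hb 0)))
  have hb1 : 0 < b 1 ^ 2 := lt_of_le_of_ne (sq_nonneg _) (Ne.symm (pow_ne_zero 2 (hb 1)))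
  have hb2 : 0 < b 2 ^ 2 := lt_of_le_of_ne (sq_nonneg _) (Ne.symm (pow_ne_zero 2 (hb 2)))
  have p0 : 0 < t₀ := by have := ha 0; have := ha 1; have := ha 2; have := ha 3; positivity
  have p1 : 0 < t₁ := by have := ha 2; have := ha 3; positivity
  have p2 : 0 < t₂ := by have := ha 0; have := ha 3; positivity
  have p3 : 0 < t₃ := by have := ha 0; have := ha 1; positivity
  have H : t₀ * t₄ = t₁ * t₃ := by
    rw [ht₀, ht₁, ht₃, ht₄]
    have : x ^ (d 3 + d 2 + d 1 + d 0) * x ^ (2 * f 0 + 2 * f 2) = x ^ (d 3 + d 2 + 2 * f 0) * x ^ (d 1 + d 0 + 2 * f 2) := by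
      rw [← pow_add, ← pow_add]; congr 1; ring
    linear_combination (a 3 * a 2 * a 1 * a 0 * (b 0 ^ 2 * b 2 ^ 2)) * this
  have E0 : t₀ - t₁ - t₂ - t₃ + t₄ = 0 := by rw [← h0, eval_pathDet_four]
  have E1 : ((d 3 + d 2 + d 1 + d 0 : ℕ) : ℝ) * t₀ - ((d 3 + d 2 + 2 * f 0 : ℕ) : ℝ) * t₁ - ((d 3 + d 0 + 2 * f 1 : ℕ) : ℝ) * t₂ -
      ((d 1 + d 0 + 2 * f 2 : ℕ) : ℝ) * t₃ + ((2 * f 0 + 2 * f 2 : ℕ) : ℝ) * t₄ = 0 := by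
    rw [← mul_eval_derivative_pathDet_four, h1, mul_zero]
  have hn : ((2 * f 0 + 2 * f 2 : ℕ) : ℝ) = ((d 3 + d 2 + 2 * f 0 : ℕ) : ℝ) + ((d 1 + d 0 + 2 * f 2 : ℕ) : ℝ) - ((d 3 + d 2 + d 1 + d 0 : ℕ) : ℝ) := by
    push_cast; ring
  have hS2 := sq_mul_eval_derivative_two_pathDet_four a d b f x
  rw [h1, mul_zero, add_zero] at hS2
  -- the degenerate case: all exponents equal forces `D₄` to be a monomial vanishing at `x`, i.e. `D₄ = 0`
  by_cases hnd : ((d 3 + d 2 + 2 * f 0 : ℕ) : ℝ) ≠ ((d 3 + d 2 + d 1 + d 0 : ℕ) : ℝ) ∨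
      ((d 1 + d 0 + 2 * f 2 : ℕ) : ℝ) ≠ ((d 3 + d 2 + d 1 + d 0 : ℕ) : ℝ)
  · have key := euler_two_neg t₀ t₁ t₂ t₃ t₄ _ _ _ _ _ p0 p1 p2 p3 H hn E0 E1 hnd
    rw [← hS2] at key
    by_contra hge
    push Not at hge
    have : 0 ≤ x ^ 2 * (derivative (derivative (pathDet a d b f 4))).eval x := by positivity
    linarith
  · exfalso
    push Not at hnd
    obtain ⟨e1, e3⟩ := hnd
    have e1' : d 3 + d 2 + 2 * f 0 = d 3 + d 2 + d 1 + d 0 := by exact_mod_cast e1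
    have e3' : d 1 + d 0 + 2 * f 2 = d 3 + d 2 + d 1 + d 0 := by exact_mod_cast e3
    -- then `E1 − n₀ E0` gives `q t₂ = 0`, so the middle exponent agrees too
    have e2 : ((d 3 + d 0 + 2 * f 1 : ℕ) : ℝ) = ((d 3 + d 2 + d 1 + d 0 : ℕ) : ℝ) := by
      have hq : (((d 3 + d 0 + 2 * f 1 : ℕ) : ℝ) - ((d 3 + d 2 + d 1 + d 0 : ℕ) : ℝ)) * t₂ = 0 := by
        rw [e1, e3] at E1 hn; linear_combination ((d 3 + d 2 + d 1 + d 0 : ℕ) : ℝ) * E0 - E1 + t₄ * hn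
      rcases mul_eq_zero.1 hq with h | h
      · linarith
      · exact absurd h p2.ne'
    have e2' : d 3 + d 0 + 2 * f 1 = d 3 + d 2 + d 1 + d 0 := by exact_mod_cast e2
    have e4' : 2 * f 0 + 2 * f 2 = d 3 + d 2 + d 1 + d 0 := by omega
    have hmono : pathDet a d b f 4 =
        C (a 3 * a 2 * a 1 * a 0 - a 3 * a 2 * b 0 ^ 2 - a 3 * a 0 * b 1 ^ 2 - a 1 * a 0 * b 2 ^ 2 + b 0 ^ 2 * b 2 ^ 2) *
          X ^ (d 3 + d 2 + d 1 + d 0) := by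
      rw [pathDet_four, e1', e2', e3', e4']; simp only [map_sub, map_add]; ring
    have hcoef : a 3 * a 2 * a 1 * a 0 - a 3 * a 2 * b 0 ^ 2 - a 3 * a 0 * b 1 ^ 2 - a 1 * a 0 * b 2 ^ 2 + b 0 ^ 2 * b 2 ^ 2 = 0 := by
      have h := h0
      rw [hmono, eval_mul, eval_C, eval_pow, eval_X] at h
      rcases mul_eq_zero.1 h with h | h
      · exact h
      · exact absurd h (pow_ne_zero _ hx.ne')
    exact hP (by rw [hmono, hcoef, map_zero, zero_mul])

/-- **No positive zero of `D₄ ≠ 0` has multiplicity three or more** (links nonzero, diagonal positive). [this file] -/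
theorem rootMultiplicity_pathDet_four_le_two (ha : ∀ t, 0 < a t) (hb : ∀ t, b t ≠ 0) (hP : pathDet a d b f 4 ≠ 0) {x : ℝ}
    (hx : 0 < x) : (pathDet a d b f 4).rootMultiplicity x ≤ 2 := by
  by_contra h
  push Not at h
  have h0 := isRoot_iterate_derivative_of_lt_rootMultiplicity (lt_trans (by norm_num : 0 < 2) h)
  have h1 := isRoot_iterate_derivative_of_lt_rootMultiplicity (lt_trans (by norm_num : 1 < 2) h)
  have h2 := isRoot_iterate_derivative_of_lt_rootMultiplicity h
  simp only [Function.iterate_zero, id_eq, Function.iterate_succ, Function.comp_apply, IsRoot.def] at h0 h1 h2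
  have := derivative_two_neg_of_double_root a d b f ha hb hP hx h0 h1
  linarith

end StaticTridiagonalRealPotential

end Summit.ValiantsHypothesis.ValiantsHypothesis.Theorems.KPlusLogSqLaw
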